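import Literature.Analysis.Hypoelliptic.AprioriLevel
import HarnessLib

/-!
# The a priori estimate, II: the spanning hypothesis and the subelliptic estimate at every level

Analysis/Hypoelliptic support file, fifteenth piece of the Fourier-side toolkit serving the
discharge of `Literature.Analysis.Distribution.Hormander1967_thm11` by Kohn's method
(M. Taylor, *Pseudodifferential Operators* (1981), Ch. XV §1, (1.17), (1.28), (1.29) and the
"improvement" remark after (1.33)). Continues `AprioriLevel.lean`.

* `HData.SpanHyp d L`: the Fourier-side form of Hörmander's bracket hypothesis — each
  coordinate derivative `∂_k` (the multiplier `2πi⟪ξ, e_k⟫` for the standard orthonormal basis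
  `e`) is a combination `∑ B_{k,w} F_w` of the operators of finitely many bracket words with
  coefficient expressions `B`;
* `epsOf L > 0`: the minimum of Kohn's exponents of the words used;
* **(1.17)** `‖u‖_ε ≤ C (‖P u‖₀ + ‖u‖₀)` (`HData.apriori_zero`), from `‖u‖_ε ≲ ‖u‖_{ε-1} +
  ∑_k ‖∂_k u‖_{ε-1}` and `S(F_w, ε_w)` for the words;
* **the subelliptic estimate at level `t`** (Taylor (1.28) and the improvement after (1.33)):
  `‖v‖_{t+ε} + ∑_j ‖X_j v‖_{t+ε/2} ≤ C (‖P v‖_t + ‖v‖_t)` (`HData.apriori`).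

## References

* M. E. Taylor, *Pseudodifferential Operators* (1981), Ch. XV §1.
* L. Hörmander, Acta Math. 119 (1967), (3.4)–(3.5).
-/

noncomputable section

open MeasureTheory Set Filter Function Module
open scoped ENNReal NNReal Topology ComplexConjugate InnerProductSpace BigOperators

namespace Literature.Analysis.Hypoelliptic

variable {V : Type*} [NormedAddCommGroup V] [InnerProductSpace ℝ V] [FiniteDimensional ℝ V]
  [MeasurableSpace V] [BorelSpace V]

/-! ### `‖u‖_ε ≲ ‖u‖_{ε-1} + ∑_k ‖∂_k u‖_{ε-1}` -/

omit [FiniteDimensional ℝ V] [MeasurableSpace V] [BorelSpace V] in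
/-- `‖ξ‖ ≤ ∑_k |⟪ξ, e_k⟫|` for an orthonormal basis. [folklore] -/
theorem norm_le_sum_abs_inner {ι : Type*} [Fintype ι] (b : OrthonormalBasis ι ℝ V) (ξ : V) :
    ‖ξ‖ ≤ ∑ k, |⟪ξ, b k⟫_ℝ| := by
  conv_lhs => rw [← b.sum_repr' ξ]
  refine (norm_sum_le _ _).trans (Finset.sum_le_sum fun k _ => ?_)
  rw [norm_smul, b.orthonormal.1 k, mul_one, Real.norm_eq_abs, real_inner_comm]

omit [FiniteDimensional ℝ V] [MeasurableSpace V] [BorelSpace V] in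
/-- `⟨ξ⟩ ≤ 1 + (2π)⁻¹ ∑_k ‖2πi⟪ξ, e_k⟫‖`. [folklore] -/
theorem bw_one_le_sum_linMul {ι : Type*} [Fintype ι] (b : OrthonormalBasis ι ℝ V) (ξ : V) :
    bw 1 ξ ≤ 1 + (2 * Real.pi)⁻¹ * ∑ k, ‖linMul (b k) ξ‖ := by
  refine (bw_one_le ξ).trans (add_le_add le_rfl ?_)
  rw [Finset.mul_sum]
  refine (norm_le_sum_abs_inner b ξ).trans (Finset.sum_le_sum fun k _ => ?_)
  rw [norm_linMul, ← mul_assoc, inv_mul_cancel₀ (by positivity), one_mul]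

/-- The weighted norm of the pointwise norm. [folklore] -/
theorem wnorm_ofReal_norm (s : ℝ) (F : V → ℂ) :
    wnorm s (fun ξ => ((‖F ξ‖ : ℝ) : ℂ)) = wnorm s F :=
  le_antisymm (wnorm_le_of_enorm_le fun ξ => by simp [enorm])
    (wnorm_le_of_enorm_le fun ξ => by simp [enorm])

/-- Measurability of the pointwise norm as a complex function. [folklore] -/
theorem aestronglyMeasurable_ofReal_norm {F : V → ℂ} (hF : AEStronglyMeasurable F volume) :
    AEStronglyMeasurable (fun ξ => ((‖F ξ‖ : ℝ) : ℂ)) volume :=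
  Complex.continuous_ofReal.comp_aestronglyMeasurable hF.norm

/-- A finite sum of weighted norms bounds the weighted norm of the sum. [folklore] -/
theorem wnorm_finset_sum_le {ι : Type*} (S : Finset ι) (s : ℝ) {F : ι → V → ℂ}
    (hF : ∀ k, AEStronglyMeasurable (F k) volume) :
    wnorm s (fun ξ => ∑ k ∈ S, F k ξ) ≤ ∑ k ∈ S, wnorm s (F k) := by
  classical
  induction S using Finset.induction_on with
  | empty => simp [wnorm]
  | insert a S ha ih =>
    simp only [Finset.sum_insert ha]
    refine (wnorm_add_le (hF a) ?_).trans (add_le_add le_rfl ih)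
    exact Finset.aestronglyMeasurable_fun_sum S fun k _ => hF k

/-- The comparison function `ξ ↦ ‖u ξ‖ + (2π)⁻¹ ∑_k ‖2πi⟪ξ,e_k⟫ u ξ‖` (as a complex function).
[folklore] -/
def auxG {ι : Type*} [Fintype ι] (b : OrthonormalBasis ι ℝ V) (u : V → ℂ) : V → ℂ :=
  fun ξ => ((‖u ξ‖ + (2 * Real.pi)⁻¹ * ∑ k, ‖linMul (b k) ξ * u ξ‖ : ℝ) : ℂ)

omit [FiniteDimensional ℝ V] [MeasurableSpace V] [BorelSpace V] in
/-- The real value of `auxG` is nonnegative. [folklore] -/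
theorem auxG_re_nonneg {ι : Type*} [Fintype ι] (b : OrthonormalBasis ι ℝ V) (u : V → ℂ) (ξ : V) :
    0 ≤ ‖u ξ‖ + (2 * Real.pi)⁻¹ * ∑ k, ‖linMul (b k) ξ * u ξ‖ := by positivity

omit [FiniteDimensional ℝ V] [MeasurableSpace V] [BorelSpace V] in
/-- Pointwise: `‖⟨ξ⟩ u ξ‖ ≤ ‖auxG ξ‖`. [folklore] -/
theorem norm_bw_mul_le_auxG {ι : Type*} [Fintype ι] (b : OrthonormalBasis ι ℝ V) (u : V → ℂ) (ξ : V) :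
    ‖(bw 1 ξ : ℂ) * u ξ‖ ≤ ‖auxG b u ξ‖ := by
  unfold auxG
  rw [Complex.norm_real, Real.norm_eq_abs, abs_of_nonneg (auxG_re_nonneg b u ξ), norm_mul,
    Complex.norm_real, Real.norm_eq_abs, abs_of_nonneg (bw_nonneg 1 ξ)]
  have h := bw_one_le_sum_linMul b ξ
  have hu0 := norm_nonneg (u ξ)
  calc bw 1 ξ * ‖u ξ‖ ≤ (1 + (2 * Real.pi)⁻¹ * ∑ k, ‖linMul (b k) ξ‖) * ‖u ξ‖ :=
        mul_le_mul_of_nonneg_right h hu0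
    _ = ‖u ξ‖ + (2 * Real.pi)⁻¹ * ∑ k, ‖linMul (b k) ξ * u ξ‖ := by
        simp only [norm_mul]
        rw [add_mul, one_mul, mul_assoc, Finset.sum_mul]

omit [FiniteDimensional ℝ V] [MeasurableSpace V] [BorelSpace V] in
/-- `auxG` split into complex summands. [folklore] -/
theorem auxG_eq {ι : Type*} [Fintype ι] (b : OrthonormalBasis ι ℝ V) (u : V → ℂ) :
    auxG b u = fun ξ => ((‖u ξ‖ : ℝ) : ℂ) +
      (((2 * Real.pi)⁻¹ : ℝ) : ℂ) * ∑ k, ((‖linMul (b k) ξ * u ξ‖ : ℝ) : ℂ) := by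
  ext ξ; unfold auxG; push_cast; rfl

/-- **`‖u‖_ε ≤ ‖u‖_{ε-1} + (2π)⁻¹ ∑_k ‖∂_k u‖_{ε-1}`** for `u ∈ Nice`. [folklore] -/
theorem rn_le_rn_sub_one_add {ι : Type*} [Fintype ι] (b : OrthonormalBasis ι ℝ V) (ε : ℝ)
    {u : V → ℂ} (hu : Nice u) :
    rn ε u ≤ rn (ε - 1) u + (2 * Real.pi)⁻¹ * ∑ k, rn (ε - 1) ((Sym.lin (b k)).apply u) := by
  -- `wnorm ε u = wnorm (ε - 1) (⟨·⟩ u) ≤ wnorm (ε - 1) auxG`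
  have h1 : wnorm ε u ≤ wnorm (ε - 1) (auxG b u) := by
    have := wnorm_bw_mul (ε - 1) 1 u
    rw [show ε - 1 + 1 = ε by ring] at this
    rw [← this]
    refine wnorm_le_of_enorm_le fun ξ => ?_
    rw [← ofReal_norm, ← ofReal_norm]
    exact ENNReal.ofReal_le_ofReal (norm_bw_mul_le_auxG b u ξ)
  -- split
  have hm1 : AEStronglyMeasurable (fun ξ => ((‖u ξ‖ : ℝ) : ℂ)) volume :=
    aestronglyMeasurable_ofReal_norm hu.1
  have hmk : ∀ k, AEStronglyMeasurable (fun ξ => ((‖linMul (b k) ξ * u ξ‖ : ℝ) : ℂ)) volume :=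
    fun k => aestronglyMeasurable_ofReal_norm ((measurable_linMul (b k)).aestronglyMeasurable.mul hu.1)
  have h2 : wnorm (ε - 1) (auxG b u) ≤ wnorm (ε - 1) u +
      ‖(((2 * Real.pi)⁻¹ : ℝ) : ℂ)‖ₑ * ∑ k, wnorm (ε - 1) ((Sym.lin (b k)).apply u) := by
    rw [auxG_eq]
    refine (wnorm_add_le hm1 ((Finset.aestronglyMeasurable_fun_sum _ fun k _ => hmk k).const_mul _)).trans ?_
    rw [wnorm_ofReal_norm, wnorm_const_mul]
    refine add_le_add le_rfl (mul_le_mul' le_rfl ?_)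
    refine (wnorm_finset_sum_le _ _ hmk).trans (Finset.sum_le_sum fun k _ => ?_)
    rw [wnorm_ofReal_norm]; rfl
  -- to real numbers
  have hfin : ∀ k, wnorm (ε - 1) ((Sym.lin (b k)).apply u) < ∞ := fun k =>
    ((Sym.cert_lin (b k)).nice_apply hu).2 _
  have hpi : ‖(((2 * Real.pi)⁻¹ : ℝ) : ℂ)‖ₑ = ENNReal.ofReal (2 * Real.pi)⁻¹ := by
    rw [← ofReal_norm, Complex.norm_real, Real.norm_eq_abs, abs_of_nonneg (by positivity)]
  have hsum_ne : ∑ k, wnorm (ε - 1) ((Sym.lin (b k)).apply u) ≠ ∞ :=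
    ENNReal.sum_ne_top.2 fun k _ => (hfin k).ne
  have hmul_ne : ‖(((2 * Real.pi)⁻¹ : ℝ) : ℂ)‖ₑ * ∑ k, wnorm (ε - 1) ((Sym.lin (b k)).apply u) ≠ ∞ := by
    rw [hpi]; exact ENNReal.mul_ne_top ENNReal.ofReal_ne_top hsum_ne
  have hR := ENNReal.add_ne_top.2 ⟨(hu.2 (ε - 1)).ne, hmul_ne⟩
  have := ENNReal.toReal_mono hR (h1.trans h2)
  rw [ENNReal.toReal_add (hu.2 _).ne hmul_ne, ENNReal.toReal_mul, hpi,
    ENNReal.toReal_ofReal (by positivity), ENNReal.toReal_sum (fun k _ => (hfin k).ne)] at this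
  exact this

/-! ### The spanning hypothesis -/

namespace HData

open Sym Field BWord

variable (d : HData V)

/-- **The spanning hypothesis on the Fourier side**: each coordinate derivative `∂_k`
(`lin e_k` for the standard orthonormal basis `e`) is, on `Nice`, a combination
`∑ B_{k,w} F_w` of bracket-word operators with certified coefficient expressions `B`.
[folklore] -/
def SpanHyp (L : Fin (finrank ℝ V) → List (Sym V × BWord d.J)) : Prop :=
  (∀ k, ∀ p ∈ L k, IsCoef p.1 ∧ Cert p.1) ∧
    ∀ k, Sym.lin (stdOrthonormalBasis ℝ V k) ≈
      Sym.sum ((L k).map fun p => comp p.1 (toSym (d.fieldOf p.2)))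

/-- The list of Kohn exponents of the words used. [folklore] -/
def expList (L : Fin (finrank ℝ V) → List (Sym V × BWord d.J)) : List ℝ :=
  (List.finRange (finrank ℝ V)).flatMap fun k => (L k).map fun p => expOf p.2

/-- **The gain** `ε = min_w ε_w` over the words used (and `≤ 1`). [folklore] -/
def epsOf (L : Fin (finrank ℝ V) → List (Sym V × BWord d.J)) : ℝ :=
  (d.expList L).foldr min 1

omit [MeasurableSpace V] [BorelSpace V] in
/-- A `foldr min 1` over positive reals is positive. [folklore] -/
theorem foldr_min_pos : ∀ {l : List ℝ}, (∀ x ∈ l, 0 < x) → 0 < l.foldr min 1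
  | [], _ => one_pos
  | x :: l, h => by
    rw [List.foldr_cons]
    exact lt_min (h x List.mem_cons_self) (foldr_min_pos fun y hy => h y (List.mem_cons_of_mem _ hy))

omit [MeasurableSpace V] [BorelSpace V] in
/-- A `foldr min 1` is at most `1`. [folklore] -/
theorem foldr_min_le_one : ∀ l : List ℝ, l.foldr min 1 ≤ 1
  | [] => le_rfl
  | x :: l => by rw [List.foldr_cons]; exact (min_le_right _ _).trans (foldr_min_le_one l)

omit [MeasurableSpace V] [BorelSpace V] in
/-- A `foldr min 1` is at most each member. [folklore] -/
theorem foldr_min_le : ∀ {l : List ℝ} {x : ℝ}, x ∈ l → l.foldr min 1 ≤ x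
  | [], _, h => (List.not_mem_nil h).elim
  | y :: l, x, h => by
    rw [List.foldr_cons]
    rcases List.mem_cons.1 h with rfl | h
    · exact min_le_left _ _
    · exact (min_le_right _ _).trans (foldr_min_le h)

omit [FiniteDimensional ℝ V] [BorelSpace V] in
/-- The gain is positive. [folklore] -/
theorem epsOf_pos (L : Fin (finrank ℝ V) → List (Sym V × BWord d.J)) : 0 < d.epsOf L :=
  foldr_min_pos fun x hx => by
    simp only [expList, List.mem_flatMap, List.mem_map] at hx
    obtain ⟨k, _, p, _, rfl⟩ := hx
    exact expOf_pos p.2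

omit [FiniteDimensional ℝ V] [BorelSpace V] in
/-- The gain is at most `1`. [folklore] -/
theorem epsOf_le_one (L : Fin (finrank ℝ V) → List (Sym V × BWord d.J)) : d.epsOf L ≤ 1 :=
  foldr_min_le_one _

omit [FiniteDimensional ℝ V] [BorelSpace V] in
/-- The gain is at most the exponent of each word used. [folklore] -/
theorem epsOf_le {L : Fin (finrank ℝ V) → List (Sym V × BWord d.J)} {k : Fin (finrank ℝ V)}
    {p : Sym V × BWord d.J} (hp : p ∈ L k) : d.epsOf L ≤ expOf p.2 :=
  foldr_min_le (by
    simp only [expList, List.mem_flatMap, List.mem_map]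
    exact ⟨k, List.mem_finRange k, p, hp, rfl⟩)

/-! ### (1.17): the a priori estimate at level `0` -/

/-- The contribution of one list: `∑_{(B,w) ∈ l} ‖B F_w u‖_{ε-1} ≤ C (‖Pu‖₀ + ‖u‖₀)`. [folklore] -/
theorem rn_list_le {ε : ℝ} : ∀ {l : List (Sym V × BWord d.J)},
    (∀ p ∈ l, IsCoef p.1 ∧ Cert p.1) → (∀ p ∈ l, ε ≤ expOf p.2) →
    ∃ C : ℝ, 0 ≤ C ∧ ∀ u : V → ℂ, Nice u →
      (l.map fun p => rn (ε - 1) ((comp p.1 (toSym (d.fieldOf p.2))).apply u)).sum ≤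
        C * (rn 0 (d.opP.apply u) + rn 0 u)
  | [], _, _ => ⟨0, le_rfl, fun u _ => by simp⟩
  | p :: l, hl, hε => by
    obtain ⟨C, hC, h⟩ := rn_list_le (l := l) (fun q hq => hl q (List.mem_cons_of_mem _ hq))
      (fun q hq => hε q (List.mem_cons_of_mem _ hq))
    obtain ⟨hco, hce⟩ := hl p List.mem_cons_self
    obtain ⟨B, hB, hBb⟩ := hce.rn_le (t := ε - 1) (t' := ε - 1) (by rw [hco.ord_eq]; simp)
    obtain ⟨D, hD, hDb⟩ := d.kohnS_fieldOf p.2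
    have hcF := (d.certF_fieldOf p.2).cert_toSym
    refine ⟨B * D + C, by positivity, fun u hu => ?_⟩
    rw [List.map_cons, List.sum_cons, apply_comp]
    have hFu : Nice ((toSym (d.fieldOf p.2)).apply u) := hcF.nice_apply hu
    have h1 := hBb _ hFu
    have h2 : rn (ε - 1) ((toSym (d.fieldOf p.2)).apply u) ≤ D * (rn 0 (d.opP.apply u) + rn 0 u) :=
      (rn_mono (by have := hε p List.mem_cons_self; linarith) hFu).trans (hDb u hu)
    have h3 := h u hu
    have := rn_nonneg 0 (d.opP.apply u); have := rn_nonneg 0 u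
    nlinarith only [h1, h2, h3, hB, hD, this, rn_nonneg 0 (d.opP.apply u)]

/-- **(1.17), the a priori estimate at level `0`**: under the spanning hypothesis,
`‖u‖_ε ≤ C (‖P u‖₀ + ‖u‖₀)` for all `u ∈ Nice`, with `ε = epsOf L` (Fourier-side form of
Taylor's (1.17) / Hörmander's (3.5)). [cite: Taylor1981, Ch. XV §1 (1.17)] -/
theorem apriori_zero {L : Fin (finrank ℝ V) → List (Sym V × BWord d.J)} (hL : d.SpanHyp L) :
    ∃ C : ℝ, 0 ≤ C ∧ ∀ u : V → ℂ, Nice u →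
      rn (d.epsOf L) u ≤ C * (rn 0 (d.opP.apply u) + rn 0 u) := by
  set ε := d.epsOf L with hε
  choose C hC0 hC using fun k => d.rn_list_le (ε := ε) (l := L k) (hL.1 k) (fun p hp => d.epsOf_le hp)
  refine ⟨1 + (2 * Real.pi)⁻¹ * ∑ k, C k,
    add_nonneg zero_le_one (mul_nonneg (by positivity) (Finset.sum_nonneg fun k _ => hC0 k)),
    fun u hu => ?_⟩
  have h0 := rn_le_rn_sub_one_add (stdOrthonormalBasis ℝ V) ε hu
  have h1 : rn (ε - 1) u ≤ rn 0 u :=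
    rn_mono (by have := d.epsOf_le_one L; linarith) hu
  have h2 : ∀ k, rn (ε - 1) ((Sym.lin (stdOrthonormalBasis ℝ V k)).apply u) ≤
      C k * (rn 0 (d.opP.apply u) + rn 0 u) := fun k => by
    have hcl : ∀ s ∈ (L k).map (fun p => comp p.1 (toSym (d.fieldOf p.2))), Cert s := by
      intro s hs
      obtain ⟨p, hp, rfl⟩ := List.mem_map.1 hs
      exact ⟨(hL.1 k p hp).2, (d.certF_fieldOf p.2).cert_toSym⟩
    rw [hL.2 k u hu]
    refine (rn_sum_apply_le hcl _ hu).trans ?_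
    rw [List.map_map]
    exact hC k u hu
  have h3 : ∑ k, rn (ε - 1) ((Sym.lin (stdOrthonormalBasis ℝ V k)).apply u) ≤
      (∑ k, C k) * (rn 0 (d.opP.apply u) + rn 0 u) := by
    rw [Finset.sum_mul]; exact Finset.sum_le_sum fun k _ => h2 k
  have := rn_nonneg 0 (d.opP.apply u); have := rn_nonneg 0 u
  have hpi : 0 ≤ (2 * Real.pi)⁻¹ := by positivity
  nlinarith only [h0, h1, h3, mul_le_mul_of_nonneg_left h3 hpi, this, rn_nonneg 0 (d.opP.apply u)]

/-! ### The subelliptic estimate at every level -/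

/-- **The subelliptic estimate at level `t`, first half** (Taylor (1.28)):
`‖v‖_{t+ε} ≤ C (‖P v‖_t + ‖v‖_t)` for `v ∈ Nice`. [folklore] -/
theorem apriori_level {L : Fin (finrank ℝ V) → List (Sym V × BWord d.J)} (hL : d.SpanHyp L)
    (t : ℝ) : ∃ C : ℝ, 0 ≤ C ∧ ∀ v : V → ℂ, Nice v →
      rn (t + d.epsOf L) v ≤ C * (rn t (d.opP.apply v) + rn t v) := by
  obtain ⟨C₀, hC₀, h₀⟩ := d.apriori_zero hL
  obtain ⟨CC, hCC, hC⟩ := d.rn_comm_opP_le (cert_bessel t) trivial 0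
  obtain ⟨CX, hCX, hX⟩ := d.rn_Xs_le_level t
  simp only [ord_bessel, zero_add] at hC
  refine ⟨C₀ * (2 + CC * (d.J * CX + 1)), by positivity, fun v hv => ?_⟩
  have hw : Nice ((bessel t).apply v) := nice_bessel t hv
  have hPv : Nice (d.opP.apply v) := d.cert_opP.nice_apply hv
  have h1 := h₀ _ hw
  rw [rn_bessel, add_comm (d.epsOf L) t, rn_bessel, zero_add] at h1
  -- `‖P Λ^t v‖₀ ≤ ‖P v‖_t + ‖[P, Λ^t] v‖₀`
  have hcm : Nice ((Sym.comm d.opP (bessel t)).apply v) :=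
    ((cert_comm_iff _ _).2 ⟨d.cert_opP, cert_bessel t⟩).nice_apply hv
  have h2 : rn 0 (d.opP.apply ((bessel t).apply v)) ≤
      rn t (d.opP.apply v) + CC * ((∑ j, rn t ((d.Xs j).apply v)) + rn t v) := by
    rw [d.apply_opP_bessel t v]
    refine (rn_add_le 0 (nice_bessel t hPv) hcm).trans ?_
    rw [rn_bessel, zero_add]
    exact add_le_add le_rfl (hC v hv)
  have h3 : ∑ j, rn t ((d.Xs j).apply v) ≤ d.J * CX * (rn t (d.opP.apply v) + rn t v) := by
    calc ∑ j, rn t ((d.Xs j).apply v) ≤ ∑ _j : Fin d.J, CX * (rn t (d.opP.apply v) + rn t v) :=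
          Finset.sum_le_sum fun j _ => hX j v hv
      _ = d.J * CX * (rn t (d.opP.apply v) + rn t v) := by
          rw [Finset.sum_const, Finset.card_univ, Fintype.card_fin, nsmul_eq_mul]; ring
  have hp := rn_nonneg t (d.opP.apply v); have hn := rn_nonneg t v
  have hsx0 := Finset.sum_nonneg fun j (_ : j ∈ Finset.univ) => rn_nonneg t ((d.Xs j).apply v)
  have h4 := mul_le_mul_of_nonneg_left (h2.trans (add_le_add le_rfl
    (mul_le_mul_of_nonneg_left (add_le_add h3 le_rfl) hCC))) hC₀
  nlinarith only [h1, h4, hp, hn, hC₀, hCC, hCX, mul_nonneg hC₀ hCC]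

/-- **The subelliptic estimate at level `t`** (Taylor (1.28) with the improvement after
(1.33)): `‖v‖_{t+ε} + ∑_j ‖X_j v‖_{t+ε/2} ≤ C (‖P v‖_t + ‖v‖_t)` for all `v ∈ Nice`
(Fourier-side form). [cite: Taylor1981, Ch. XV §1 (1.28)] -/
theorem apriori {L : Fin (finrank ℝ V) → List (Sym V × BWord d.J)} (hL : d.SpanHyp L) (t : ℝ) :
    ∃ C : ℝ, 0 ≤ C ∧ ∀ v : V → ℂ, Nice v →
      rn (t + d.epsOf L) v + ∑ j, rn (t + d.epsOf L / 2) ((d.Xs j).apply v) ≤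
        C * (rn t (d.opP.apply v) + rn t v) := by
  have hε0 : 0 < d.epsOf L := d.epsOf_pos L
  obtain ⟨C₁, hC₁, h₁⟩ := d.apriori_level hL t
  obtain ⟨K, hK, hE⟩ := d.energy
  choose D hD0 hD using fun j => d.rn_Xs_bessel_le j (t + d.epsOf L / 2) 0
  obtain ⟨CC, hCC, hC⟩ := d.rn_comm_opP_le (cert_bessel (t + d.epsOf L / 2)) trivial (-(d.epsOf L / 2))
  obtain ⟨CX, hCX, hX⟩ := d.rn_Xs_le_level t
  simp only [ord_bessel, zero_add] at hC hD
  set ε := d.epsOf L with hε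
  set s := t + ε / 2 with hs
  have hsε : -(ε / 2) + s = t := by rw [hs]; ring
  rw [hsε] at hC
  set L' : ℝ := ∑ j, D j with hL'
  have hL'0 : 0 ≤ L' := Finset.sum_nonneg fun j _ => hD0 j
  have hDL : ∀ j, D j ≤ L' := fun j => Finset.single_le_sum (f := D) (fun j _ => hD0 j) (Finset.mem_univ j)
  -- the final constant
  set M : ℝ := 2 * C₁ + 2 * CC * (d.J * CX + 1) * C₁ + K * C₁ ^ 2 + L' ^ 2 * C₁ ^ 2 + 1 with hM
  have hM0 : 0 ≤ M := by positivity
  refine ⟨C₁ + d.J * Real.sqrt (2 * M + 2 * L' ^ 2 * C₁ ^ 2), by positivity, fun v hv => ?_⟩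
  set p := rn t (d.opP.apply v) with hp
  set n := rn t v with hn
  have hp0 : 0 ≤ p := rn_nonneg _ _
  have hn0 : 0 ≤ n := rn_nonneg _ _
  set m := rn (t + ε) v with hm
  have hm0 : 0 ≤ m := rn_nonneg _ _
  have hm1 : m ≤ C₁ * (p + n) := h₁ v hv
  -- `w = Λ^s v`
  set w := (bessel s).apply v with hw
  have hwN : Nice w := nice_bessel s hv
  have hPv : Nice (d.opP.apply v) := d.cert_opP.nice_apply hv
  have hns : rn 0 w ≤ m := by
    rw [hw, rn_bessel, zero_add]
    exact rn_mono (by rw [hs]; linarith) hv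
  have hwε : rn (ε / 2) w = m := by rw [hw, rn_bessel]; congr 1; rw [hs]; ring
  -- energy for `w`
  have hEw := hE w hwN
  have hcm : Nice ((Sym.comm d.opP (bessel s)).apply v) :=
    ((cert_comm_iff _ _).2 ⟨d.cert_opP, cert_bessel s⟩).nice_apply hv
  have hsplit : pairing (d.opP.apply w) w =
      pairing ((bessel s).apply (d.opP.apply v)) w + pairing ((Sym.comm d.opP (bessel s)).apply v) w := by
    have h0 : InH (-0) ((bessel s).apply v) := by rw [neg_zero]; exact hwN.inH 0
    rw [hw, d.apply_opP_bessel s v, pairing_add_left ((nice_bessel s hPv).inH 0) (hcm.inH 0) h0]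
  -- `|⟨Λ^s P v, Λ^s v⟩| = |⟨Λ^t P v, Λ^{t+ε} v⟩| ≤ p m`
  have b1 : ‖pairing ((bessel s).apply (d.opP.apply v)) w‖ ≤ p * m := by
    rw [hw, pairing_bessel_shift s (ε / 2), show s - ε / 2 = t by rw [hs]; ring,
      show s + ε / 2 = t + ε by rw [hs]; ring]
    have h := norm_pairing_le_rn 0 (nice_bessel t hPv) (nice_bessel (t + ε) hv)
    rw [neg_zero, rn_bessel, rn_bessel, zero_add, zero_add] at h
    exact h
  -- `|⟨[P,Λ^s] v, w⟩| ≤ ‖[P,Λ^s]v‖_{-ε/2} ‖w‖_{ε/2} ≤ CC (∑‖X_j v‖_t + n) m`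
  have hsx : ∑ j, rn t ((d.Xs j).apply v) ≤ d.J * CX * (p + n) := by
    calc ∑ j, rn t ((d.Xs j).apply v) ≤ ∑ _j : Fin d.J, CX * (p + n) :=
          Finset.sum_le_sum fun j _ => hX j v hv
      _ = d.J * CX * (p + n) := by
          rw [Finset.sum_const, Finset.card_univ, Fintype.card_fin, nsmul_eq_mul]; ring
  have b2 : ‖pairing ((Sym.comm d.opP (bessel s)).apply v) w‖ ≤ CC * (d.J * CX + 1) * (p + n) * m := by
    have h := norm_pairing_le_shift (ε / 2) hcm hwN
    rw [hwε] at h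
    refine h.trans ?_
    have h' := hC v hv
    have : CC * ((∑ j, rn t ((d.Xs j).apply v)) + rn t v) ≤ CC * (d.J * CX + 1) * (p + n) := by
      nlinarith only [hsx, hCC, hp0, hn0, mul_le_mul_of_nonneg_left hsx hCC]
    exact mul_le_mul_of_nonneg_right (h'.trans this) hm0
  have hre : |(pairing (d.opP.apply w) w).re| ≤ p * m + CC * (d.J * CX + 1) * (p + n) * m := by
    rw [hsplit]
    exact (abs_re_le_norm _).trans ((norm_add_le _ _).trans (add_le_add b1 b2))
  -- `b_j = ‖X_j w‖₀ ≥ ‖X_j v‖_s - L' m`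
  set a : Fin d.J → ℝ := fun j => rn s ((d.Xs j).apply v) with ha
  set b : Fin d.J → ℝ := fun j => rn 0 ((d.Xs j).apply w) with hb
  have ha0 : ∀ j, 0 ≤ a j := fun j => rn_nonneg _ _
  have hb0 : ∀ j, 0 ≤ b j := fun j => rn_nonneg _ _
  have hab : ∀ j, a j ≤ b j + L' * m := fun j => by
    have h := (hD j v hv).2
    have hn' : rn s v ≤ m := rn_mono (by rw [hs]; linarith) hv
    calc a j ≤ b j + D j * rn s v := h
      _ ≤ b j + L' * m := add_le_add le_rfl (mul_le_mul (hDL j) hn' (rn_nonneg _ _) hL'0)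
  have hsumb : ∑ j, b j ^ 2 ≤ 2 * (p * m + CC * (d.J * CX + 1) * (p + n) * m) + K * m ^ 2 := by
    have h0 : rn 0 w ^ 2 ≤ m ^ 2 := pow_le_pow_left₀ (rn_nonneg _ _) hns 2
    have := hEw
    simp only [hb]
    nlinarith only [this, hre, h0, hK]
  -- `∑ b² ≤ M (p + n)²`
  have hsumb' : ∑ j, b j ^ 2 ≤ M * (p + n) ^ 2 := by
    have e1 : p * m ≤ C₁ * (p + n) ^ 2 := by nlinarith only [hm1, hp0, hn0, hm0, mul_nonneg hp0 hn0]
    have e2 : CC * (d.J * CX + 1) * (p + n) * m ≤ CC * (d.J * CX + 1) * C₁ * (p + n) ^ 2 := by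
      have hc : 0 ≤ CC * (d.J * CX + 1) * (p + n) := by positivity
      nlinarith only [mul_le_mul_of_nonneg_left hm1 hc]
    have e3 : K * m ^ 2 ≤ K * C₁ ^ 2 * (p + n) ^ 2 := by
      have := pow_le_pow_left₀ hm0 hm1 2
      nlinarith only [mul_le_mul_of_nonneg_left this hK]
    rw [hM]
    nlinarith only [hsumb, e1, e2, e3, sq_nonneg (p + n), mul_nonneg (mul_nonneg hL'0 hL'0) (sq_nonneg (C₁ * (p + n)))]
  -- each `a j ≤ √(2M + 2 L'² C₁²) (p + n)`
  have haj : ∀ j, a j ≤ Real.sqrt (2 * M + 2 * L' ^ 2 * C₁ ^ 2) * (p + n) := fun j => by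
    have h1 : a j ^ 2 ≤ 2 * b j ^ 2 + 2 * (L' * m) ^ 2 := by
      nlinarith only [hab j, ha0 j, hb0 j, mul_nonneg hL'0 hm0, sq_nonneg (b j - L' * m)]
    have h2 : b j ^ 2 ≤ ∑ i, b i ^ 2 :=
      Finset.single_le_sum (f := fun i => b i ^ 2) (fun _ _ => sq_nonneg _) (Finset.mem_univ j)
    have h3 : (L' * m) ^ 2 ≤ L' ^ 2 * C₁ ^ 2 * (p + n) ^ 2 := by
      have := mul_le_mul_of_nonneg_left hm1 hL'0
      have h' := pow_le_pow_left₀ (mul_nonneg hL'0 hm0) this 2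
      nlinarith only [h']
    have h4 : a j ^ 2 ≤ (2 * M + 2 * L' ^ 2 * C₁ ^ 2) * (p + n) ^ 2 := by
      nlinarith only [h1, h2, h3, hsumb']
    exact le_sqrt_mul_of_sq_le (ha0 j) (add_nonneg hp0 hn0) (by positivity) h4
  have hsa : ∑ j, a j ≤ d.J * Real.sqrt (2 * M + 2 * L' ^ 2 * C₁ ^ 2) * (p + n) := by
    calc ∑ j, a j ≤ ∑ _j : Fin d.J, Real.sqrt (2 * M + 2 * L' ^ 2 * C₁ ^ 2) * (p + n) :=
          Finset.sum_le_sum fun j _ => haj j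
      _ = _ := by rw [Finset.sum_const, Finset.card_univ, Fintype.card_fin, nsmul_eq_mul]; ring
  calc m + ∑ j, a j ≤ C₁ * (p + n) + d.J * Real.sqrt (2 * M + 2 * L' ^ 2 * C₁ ^ 2) * (p + n) :=
        add_le_add hm1 hsa
    _ = _ := by ring

end HData

end Literature.Analysis.Hypoelliptic
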